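/-
Copyright: statement-level skeleton of a published paper (lit-balaban cell, Phase-2 proof seat p19, gen 4). No claims beyond
what the kernel checks below.
-/
import Mathlib
import Literature.MathematicalPhysics.QuantumFieldTheory.Balaban1983to89.B3AmpIBP

/-!
# B3 — T. Bałaban, *(Higgs)₂,₃ quantum fields in a finite volume. III. Renormalization*, CMP **88** (1983) 411–445
[Balaban1983Higgs3] — Sect. 2, p. 425: the integration by parts (2.8)/(2.9) carried out at ALL the (2.4)-vertices of a
graph — *"this way we represent G′ as a sum of graphs {G′∗}"* — inside the amplitude model: the index set of the terms
(choice functions) and the data of each term IN CLOSED FORM, with the lemmas composing one more site into the closed form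

statement-level skeleton of published theorems with citation tags; proofs where landed; nothing here is a claim about
the Yang–Mills mass gap

PDF held: `paper:balaban1983-higgs-2-3-quantum-fields-finite-volume` (journal page = PDF page + 410); display (2.9) and the
sentences around it read on the ×2 render `pub-balaban/b2b-balaban-ref1/pages/1983-cmp88-higgs23-III/1983-cmp88-higgs23-III-p015-x2.png`
(p. 425).

Part of the Phase-2 work on SKELETON rows **B3.Prop2.1 / B3.Prop2.2** (unit `lit-balaban-p19` gen 4, HOME
`run/shared/lean/pub/lit-balaban/`): the (2.4) EXCEPTION of Proposition 2.1, files `B3LatticeIBP` → `B3AmpIBP` (one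
integration by parts: `rawE_site`) → `B3AmpIBPClosed` (this file) → `B3AmpIBPAll` (the identity over all sites) →
`B3AmpIBPBounds` → `B3IBPDegrees` → `B3Prop21Except24`.

WHAT IS REPRODUCED.  p. 425 [PDF 15], verbatim: *"The effect of this transformation is that the graphs (2.4) are replaced
by the graphs with degree +1. We do it for all graphs G₁, G₂^{(2)}, G₃^{(3)}, … described previously and this way we
represent G′ as a sum of graphs {G′∗}."*  KERNEL-CHECKED HERE for the raw lattice sums `rawE` of the amplitude model: given
a set `S` of SITE LINES (each `l ∈ S` with `s(l) ≠ t(l)`; distinct site vertices `s(l)`; no site vertex an endpoint of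
another site line — the situation of the single-line components `G₁, G₂^{(2)}, …` along an ordering, cf. `B3IBPDegrees`),
a direction `dir v` per vertex (the bond direction of the vertex's derivative leg, (1.8)/(1.9) p. 413) and undifferentiated
kernels `K♭_l`, such that at every site `K_l = ∂⁺_{dir s(l)}K♭_l` in the first variable and `u_{s(l)}` vanishes on the
`dir s(l)`-faces of `□(s(l))`, the terms G′∗ are indexed by the CHOICE FUNCTIONS `c ∈ choices S` (for each site: the vertex,
or one of the other lines at the site vertex), and the data of the term `c` are, in CLOSED FORM: `allU` (at a site vertex:
`−∂⁻u` or `−u(· − e_μ)`), `allK` (on a site line: `K♭`; on any other line: in each of its two variables the operation —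
differentiate / shift / keep — dictated by the site at that endpoint, `xcode` / `ycode`; jointly for a loop).  Bookkeeping
only (definitions and their unfolding / congruence lemmas, the behaviour of the codes when a site is added); the composition
with the one-site transform and the identity `E(G′(j)) = Σ_c E(G′∗_c(j))` are proved in `B3AmpIBPAll`.
-/

open Finset

namespace Literature.MathematicalPhysics.QuantumFieldTheory.Balaban1983to89.B3Ineq213

open B3Ineq215

/-! ## Operation codes and their action -/

section Codes

variable {d m : ℕ}

/-- Operation code of the line `q` in the term `o` of one site: `2` = differentiated (`q` is the hit line), `1` = shifted
(`q` comes after the hit line), `0` = kept (vertex term, or `q` before the hit line). [cite: Balaban1983Higgs3, (2.9) p.425] -/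
def opCode (o : Option (Fin m)) (q : Fin m) : ℕ := o.elim 0 fun p => if q = p then 2 else if p < q then 1 else 0

/-- `opCode none = 0`. [cite: Balaban1983Higgs3, (2.9) p.425] -/
@[simp] theorem opCode_none (q : Fin m) : opCode (none : Option (Fin m)) q = 0 := rfl

/-- `opCode (some p) q`. [cite: Balaban1983Higgs3, (2.9) p.425] -/
theorem opCode_some (p q : Fin m) : opCode (some p) q = if q = p then 2 else if p < q then 1 else 0 := rfl

/-- Codes are `≤ 2`. [cite: Balaban1983Higgs3, (2.9) p.425] -/
theorem opCode_le_two (o : Option (Fin m)) (q : Fin m) : opCode o q ≤ 2 := by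
  cases o with
  | none => simp
  | some p => rw [opCode_some]; split_ifs <;> omega

/-- The action of a code on a kernel in the flagged variables: `2` ↦ `∂⁻_μ`, `1` ↦ shift by `−e_μ`, otherwise identity.
[cite: Balaban1983Higgs3, (2.8) p.425] -/
noncomputable def apCode (n : ℕ) (s : ℝ) (μ : Fin d) (bs bt : Bool) (K : Ker d) : Ker d :=
  if n = 2 then dK s μ bs bt K else if n = 1 then shK μ bs bt K else K

/-- Code `0` keeps. [cite: Balaban1983Higgs3, (2.8) p.425] -/
@[simp] theorem apCode_zero (s : ℝ) (μ : Fin d) (bs bt : Bool) (K : Ker d) : apCode 0 s μ bs bt K = K := by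
  simp [apCode]

/-- Code `1` shifts. [cite: Balaban1983Higgs3, (2.8) p.425] -/
@[simp] theorem apCode_one (s : ℝ) (μ : Fin d) (bs bt : Bool) (K : Ker d) : apCode 1 s μ bs bt K = shK μ bs bt K := by
  simp [apCode]

/-- Code `2` differentiates. [cite: Balaban1983Higgs3, (2.8) p.425] -/
@[simp] theorem apCode_two (s : ℝ) (μ : Fin d) (bs bt : Bool) (K : Ker d) : apCode 2 s μ bs bt K = dK s μ bs bt K := by
  simp [apCode]

/-- With no flagged variable every code acts trivially, except that the difference of a constant is `0`; for the codes of
a line which is not the hit line (code `≠ 2`) the action is the identity. [cite: Balaban1983Higgs3, (2.8) p.425] -/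
theorem apCode_false_false {n : ℕ} (hn : n ≠ 2) (s : ℝ) (μ : Fin d) (K : Ker d) : apCode n s μ false false K = K := by
  unfold apCode
  rw [if_neg hn]
  split_ifs
  · funext t x y; simp [shK]
  · rfl

/-- The one-site operation `opOf p q` of `B3AmpIBP` is the action of the code `opCode (some p) q`.
[cite: Balaban1983Higgs3, (2.9) p.425] -/
theorem opOf_ap_eq_apCode (p q : Fin m) (s : ℝ) (μ : Fin d) (bs bt : Bool) (K : Ker d) :
    (opOf p q).ap s μ bs bt K = apCode (opCode (some p) q) s μ bs bt K := by
  rw [opCode_some]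
  by_cases h : q = p
  · subst h; rw [opOf_self, if_pos rfl, Op.ap_deriv, apCode_two]
  · rw [if_neg h]
    by_cases h' : p < q
    · rw [opOf_of_lt h', if_pos h', Op.ap_shift, apCode_one]
    · have hqp : q < p := lt_of_le_of_ne (not_lt.1 h') h
      rw [opOf_of_gt hqp, if_neg h', Op.ap_keep, apCode_zero]

/-- Pointwise form of the action in the first variable. [cite: Balaban1983Higgs3, (2.8) p.425] -/
theorem apCode_tf_apply (n : ℕ) (s : ℝ) (μ : Fin d) (F : Ker d) (t : ℕ) (x y : Fin d → ℕ) :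
    apCode n s μ true false F t x y
      = if n = 2 then s * (F t x y - F t (bsh μ x) y) else if n = 1 then F t (bsh μ x) y else F t x y := by
  unfold apCode
  split_ifs <;> simp [dK, shK]

/-- Pointwise form of the action in the second variable. [cite: Balaban1983Higgs3, (2.8) p.425] -/
theorem apCode_ft_apply (n : ℕ) (s : ℝ) (ν : Fin d) (F : Ker d) (t : ℕ) (x y : Fin d → ℕ) :
    apCode n s ν false true F t x y
      = if n = 2 then s * (F t x y - F t x (bsh ν y)) else if n = 1 then F t x (bsh ν y) else F t x y := by
  unfold apCode
  split_ifs <;> simp [dK, shK]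

/-- Pointwise form of the joint action (a loop). [cite: Balaban1983Higgs3, (2.8) p.425] -/
theorem apCode_tt_apply (n : ℕ) (s : ℝ) (μ : Fin d) (F : Ker d) (t : ℕ) (x y : Fin d → ℕ) :
    apCode n s μ true true F t x y
      = if n = 2 then s * (F t x y - F t (bsh μ x) (bsh μ y)) else if n = 1 then F t (bsh μ x) (bsh μ y)
        else F t x y := by
  unfold apCode
  split_ifs <;> simp [dK, shK]

/-- Operations in the first variable commute with operations in the second variable. [cite: Balaban1983Higgs3, (2.8) p.425] -/
theorem apCode_comm (a b : ℕ) (s : ℝ) (μ ν : Fin d) (K : Ker d) :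
    apCode a s μ true false (apCode b s ν false true K) = apCode b s ν false true (apCode a s μ true false K) := by
  funext t x y
  simp only [apCode_tf_apply, apCode_ft_apply]
  split_ifs <;> ring

end Codes

/-! ## Sites, choices, and the closed form of the terms -/

section Closed

variable {V : Type} [DecidableEq V] {m d : ℕ} (src tgt : Fin m → V)

/-- The lines at the vertex `v` other than `l`. [cite: Balaban1983Higgs3, (2.9) p.425] -/
def touching (v : V) (l : Fin m) : Finset (Fin m) := (univ.erase l).filter fun p => src p = v ∨ tgt p = v

/-- Membership in `touching`. [cite: Balaban1983Higgs3, (2.9) p.425] -/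
theorem mem_touching {v : V} {l p : Fin m} : p ∈ touching src tgt v l ↔ p ≠ l ∧ (src p = v ∨ tgt p = v) := by
  simp [touching]

/-- The factors the derivative of the site `l` can hit: the vertex (`none`) or another line at `s(l)`; no choice at a line
which is not a site. [cite: Balaban1983Higgs3, (2.9) p.425] -/
def opts (S : Finset (Fin m)) (l : Fin m) : Finset (Option (Fin m)) :=
  if l ∈ S then Finset.insertNone (touching src tgt (src l) l) else {none}

/-- **The index set of the graphs `{G′∗}`**: the choice functions (one hit factor per site). [cite: Balaban1983Higgs3, (2.9) p.425] -/
def choices (S : Finset (Fin m)) : Finset (Fin m → Option (Fin m)) := Fintype.piFinset (opts src tgt S)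

/-- At a non-site the only option is `none`. [cite: Balaban1983Higgs3, (2.9) p.425] -/
theorem opts_of_not_mem {S : Finset (Fin m)} {l : Fin m} (h : l ∉ S) : opts src tgt S l = {none} := by simp [opts, h]

/-- At a site the options are the vertex and the other lines at the site vertex. [cite: Balaban1983Higgs3, (2.9) p.425] -/
theorem opts_of_mem {S : Finset (Fin m)} {l : Fin m} (h : l ∈ S) :
    opts src tgt S l = Finset.insertNone (touching src tgt (src l) l) := by simp [opts, h]

/-- Adding a site changes the options only at that site. [cite: Balaban1983Higgs3, (2.9) p.425] -/
theorem opts_insert {S : Finset (Fin m)} {l₀ : Fin m} (h₀ : l₀ ∉ S) :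
    opts src tgt (insert l₀ S) = Function.update (opts src tgt S) l₀ (opts src tgt (insert l₀ S) l₀) := by
  funext l
  by_cases hl : l = l₀
  · subst hl; rw [Function.update_self]
  · rw [Function.update_of_ne hl]
    unfold opts
    simp [mem_insert, hl]

/-- A choice function of `S` takes a line of `S` to the vertex or to another line at its site vertex.
[cite: Balaban1983Higgs3, (2.9) p.425] -/
theorem choice_mem_opts {S : Finset (Fin m)} {c : Fin m → Option (Fin m)} (hc : c ∈ choices src tgt S) (l : Fin m) :
    c l ∈ opts src tgt S l :=
  Fintype.mem_piFinset.1 hc l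

/-- If the choice at the site `l` is the line `p`, then `p ≠ l` touches `s(l)`. [cite: Balaban1983Higgs3, (2.9) p.425] -/
theorem choice_some {S : Finset (Fin m)} {c : Fin m → Option (Fin m)} (hc : c ∈ choices src tgt S) {l p : Fin m}
    (h : c l = some p) : l ∈ S ∧ p ≠ l ∧ (src p = src l ∨ tgt p = src l) := by
  have hm := choice_mem_opts src tgt hc l
  rw [h] at hm
  by_cases hl : l ∈ S
  · rw [opts_of_mem src tgt hl, Finset.some_mem_insertNone, mem_touching] at hm
    exact ⟨hl, hm⟩
  · rw [opts_of_not_mem src tgt hl] at hm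
    simp at hm

variable (dir : V → Fin d) (s : ℝ) (Kb : Fin m → Ker d)

/-- The operation code of the line `q` in its FIRST variable for the choice `c`: dictated by the site at `s(q)` (if any).
[cite: Balaban1983Higgs3, (2.9) p.425] -/
def xcode (S : Finset (Fin m)) (c : Fin m → Option (Fin m)) (q : Fin m) : ℕ :=
  (S.filter fun l => l ≠ q ∧ src l = src q).sup fun l => opCode (c l) q

/-- The operation code of the line `q` in its SECOND variable: dictated by the site at `t(q)` (if any).
[cite: Balaban1983Higgs3, (2.9) p.425] -/
def ycode (S : Finset (Fin m)) (c : Fin m → Option (Fin m)) (q : Fin m) : ℕ :=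
  (S.filter fun l => l ≠ q ∧ src l = tgt q).sup fun l => opCode (c l) q

/-- **The kernels of the term `c`** (closed form): `K♭` on the site lines; on any other line the operations of its two
endpoints' sites in the corresponding variables (jointly for a loop). [cite: Balaban1983Higgs3, (2.9) p.425] -/
noncomputable def allK (S : Finset (Fin m)) (c : Fin m → Option (Fin m)) (K : Fin m → Ker d) : Fin m → Ker d :=
  fun q => if q ∈ S then Kb q else
    if src q = tgt q then apCode (xcode src S c q) s (dir (src q)) true true (K q)
    else apCode (xcode src S c q) s (dir (src q)) true false (apCode (ycode src tgt S c q) s (dir (tgt q)) false true (K q))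

/-- **The vertex functions of the term `c`** (closed form): at a site vertex `−∂⁻_{dir v}u_v` (vertex hit) or `−u_v(· −
e_{dir v})` (a line hit); unchanged elsewhere. [cite: Balaban1983Higgs3, (2.9) p.425] -/
noncomputable def allU (S : Finset (Fin m)) (c : Fin m → Option (Fin m)) (u : V → (Fin d → ℕ) → ℝ) :
    V → (Fin d → ℕ) → ℝ :=
  fun v x => if ∃ l ∈ S, src l = v then
      (if ∃ l ∈ S, src l = v ∧ c l = none then -bdiffQ s (dir v) (u v) x else -u v (bsh (dir v) x))
    else u v x

/-- The closed forms depend on the choice function only on `S`. [cite: Balaban1983Higgs3, (2.9) p.425] -/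
theorem xcode_congr {S : Finset (Fin m)} {c c' : Fin m → Option (Fin m)} (h : ∀ l ∈ S, c l = c' l) (q : Fin m) :
    xcode src S c q = xcode src S c' q :=
  Finset.sup_congr rfl fun l hl => congrArg (fun o => opCode o q) (h l (mem_filter.1 hl).1)

/-- The closed forms depend on the choice function only on `S`. [cite: Balaban1983Higgs3, (2.9) p.425] -/
theorem ycode_congr {S : Finset (Fin m)} {c c' : Fin m → Option (Fin m)} (h : ∀ l ∈ S, c l = c' l) (q : Fin m) :
    ycode src tgt S c q = ycode src tgt S c' q :=
  Finset.sup_congr rfl fun l hl => congrArg (fun o => opCode o q) (h l (mem_filter.1 hl).1)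

/-- The closed forms depend on the choice function only on `S`. [cite: Balaban1983Higgs3, (2.9) p.425] -/
theorem allK_congr {S : Finset (Fin m)} {c c' : Fin m → Option (Fin m)} (h : ∀ l ∈ S, c l = c' l) (K : Fin m → Ker d) :
    allK src tgt dir s Kb S c K = allK src tgt dir s Kb S c' K := by
  funext q
  simp only [allK, xcode_congr src h, ycode_congr src tgt h]

/-- The closed forms depend on the choice function only on `S`. [cite: Balaban1983Higgs3, (2.9) p.425] -/
theorem allU_congr {S : Finset (Fin m)} {c c' : Fin m → Option (Fin m)} (h : ∀ l ∈ S, c l = c' l)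
    (u : V → (Fin d → ℕ) → ℝ) : allU src dir s S c u = allU src dir s S c' u := by
  funext v x
  have e : (∃ l ∈ S, src l = v ∧ c l = none) ↔ (∃ l ∈ S, src l = v ∧ c' l = none) := by
    constructor
    · rintro ⟨l, hl, hv, hc⟩; exact ⟨l, hl, hv, (h l hl) ▸ hc⟩
    · rintro ⟨l, hl, hv, hc⟩; exact ⟨l, hl, hv, (h l hl).symm ▸ hc⟩
  simp only [allU, e]

/-! ### Adding a site: the codes -/

/-- No site of `S` at `s(q)`: code `0` in the first variable. [cite: Balaban1983Higgs3, (2.9) p.425] -/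
theorem xcode_eq_zero {S : Finset (Fin m)} (c : Fin m → Option (Fin m)) {q : Fin m}
    (h : ∀ l ∈ S, l ≠ q → src l ≠ src q) : xcode src S c q = 0 := by
  unfold xcode
  rw [Finset.filter_false_of_mem fun l hl hq => h l hl hq.1 hq.2, sup_empty, bot_eq_zero]

/-- No site of `S` at `t(q)`: code `0` in the second variable. [cite: Balaban1983Higgs3, (2.9) p.425] -/
theorem ycode_eq_zero {S : Finset (Fin m)} (c : Fin m → Option (Fin m)) {q : Fin m}
    (h : ∀ l ∈ S, l ≠ q → src l ≠ tgt q) : ycode src tgt S c q = 0 := by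
  unfold ycode
  rw [Finset.filter_false_of_mem fun l hl hq => h l hl hq.1 hq.2, sup_empty, bot_eq_zero]

/-- Adding the site `l₀`: the first-variable code of `q` picks up `opCode (c l₀) q` iff `s(q) = s(l₀)`, `q ≠ l₀`.
[cite: Balaban1983Higgs3, (2.9) p.425] -/
theorem xcode_insert (S : Finset (Fin m)) (c : Fin m → Option (Fin m)) (l₀ q : Fin m) :
    xcode src (insert l₀ S) c q
      = (if l₀ ≠ q ∧ src l₀ = src q then opCode (c l₀) q else 0) ⊔ xcode src S c q := by
  unfold xcode
  rw [filter_insert]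
  split_ifs with h
  · rw [sup_insert]
  · rw [← bot_eq_zero, bot_sup_eq]

/-- Adding the site `l₀`: the second-variable code of `q` picks up `opCode (c l₀) q` iff `t(q) = s(l₀)`, `q ≠ l₀`.
[cite: Balaban1983Higgs3, (2.9) p.425] -/
theorem ycode_insert (S : Finset (Fin m)) (c : Fin m → Option (Fin m)) (l₀ q : Fin m) :
    ycode src tgt (insert l₀ S) c q
      = (if l₀ ≠ q ∧ src l₀ = tgt q then opCode (c l₀) q else 0) ⊔ ycode src tgt S c q := by
  unfold ycode
  rw [filter_insert]
  split_ifs with h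
  · rw [sup_insert]
  · rw [← bot_eq_zero, bot_sup_eq]

/-- With no site the kernels are the original ones. [cite: Balaban1983Higgs3, (2.9) p.425] -/
theorem allK_empty (c : Fin m → Option (Fin m)) (K : Fin m → Ker d) : allK src tgt dir s Kb ∅ c K = K := by
  funext q
  have hx : xcode src ∅ c q = 0 := xcode_eq_zero src c (by simp)
  have hy : ycode src tgt ∅ c q = 0 := ycode_eq_zero src tgt c (by simp)
  simp [allK, hx, hy]

/-- With no site the vertex functions are the original ones. [cite: Balaban1983Higgs3, (2.9) p.425] -/
theorem allU_empty (c : Fin m → Option (Fin m)) (u : V → (Fin d → ℕ) → ℝ) : allU src dir s ∅ c u = u := by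
  funext v x
  simp [allU]

end Closed

end Literature.MathematicalPhysics.QuantumFieldTheory.Balaban1983to89.B3Ineq213
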